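import Literature.NumberTheory.EllipticCurves.BSDSelmerCMPConverse
import Literature.NumberTheory.EllipticCurves.Rank1Residual.Predicates
import Literature.NumberTheory.EllipticCurves.LeadingTerm
import Literature.NumberTheory.DiophantineGeometry.Conductor
import Literature.NumberTheory.EllipticCurves.DeuringSupersingularReduction
import Literature.NumberTheory.EllipticCurves.SelmerCorankControlRatProofs
import Literature.NumberTheory.EllipticCurves.ComplexMultiplication
import Literature.NumberTheory.EllipticCurves.ComplexMultiplicationBurungaleFlachPrimaryProofs
import HarnessLib

/-!
# Burungale–Castella–Skinner–Tian 2022, Theorem A: the rank-one `p`-converse for CM elliptic curves over `ℚ` at EVERY good ordinary prime `p` (including `p = 2, 3`)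

HONEST FRAMING (cell `b2b-bsdres`, run/shared/lean/b2b/bsd-rank1-residual/; literature typer
seat `b2b-bsdres-lit-bst`): the goal of the cell is to DELETE the COMBINATION-SHAPED residual
classes for ALL analytic-rank `≤ 1` elliptic curves over `ℚ` — "full BSD formula for every rank
`≤ 1` curve in class C" assembled STRICTLY from published theorems — so that the rank-`≤ 1`
remainder becomes exactly the CONSTRUCTION-SHAPED classes, which are TYPED (missing-input `Prop`s),
NOT attempted. This is not "finishing BSD". This file vendors ONE published theorem (a named fact,
nothing asserted; D-0014) and proves only bookkeeping around it; it says exactly which `(E, p)` it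
bears on, in particular the `p = 2, 3` corner.

## Citation header

A. Burungale, F. Castella, C. Skinner, Y. Tian, *`p^∞`-Selmer groups and rational points on CM
elliptic curves*, Ann. Math. Québec **46** (2022), no. 2, 325–346, doi:10.1007/s40316-022-00203-y
[BurungaleCastellaSkinnerTian2022] (received 21 July 2021; published online 8 July 2022; © The
Authors, open access CC BY 4.0; CRM-ISM-AMQ prize 2023). READ for this file (2026-08-20) from the
PUBLISHER'S typeset PDF as deposited in CaltechAUTHORS (record `1791g-a9y92`, file
`s40316-022-00203-y.pdf`, 22 pp. = journal pp. 325–346; text key `paper:url-22916c5d226d`,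
PDF page `n` = journal page `324 + n`). The held JATS text `paper:doi-10-1007-s40316-022-00203-y`
DROPS every displayed formula (e.g. the two displays of Theorem A) and must not be quoted for
them; the authors' preprint (`web.math.ucsb.edu/~castella/CM.pdf`, 18 pp., key
`paper:url-5cf118445e61`) differs from the version of record (there Thm. A is stated for CM by the
MAXIMAL order and the abstract for "`p` split"; Cor. B of the journal version is absent).

**Theorem A, verbatim** (Introduction, p. 326): "Let `E/ℚ` be an elliptic curve with complex
multiplication by an order of an imaginary quadratic field `K` of discriminant `−D_K < 0`. Assume
that the Hecke character associated to `E` has conductor exactly divisible by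
`𝔡_K := (√−D_K)`. Let `p` be a prime of good ordinary reduction for `E`. Then
`corank_{ℤ_p} Sel_{p^∞}(E/ℚ) = 1 ⟹ ord_{s=1} L(E, s) = 1.`
In particular, if `corank_{ℤ_p} Sel_{p^∞}(E/ℚ) = 1` then `rank_ℤ E(ℚ) = 1` and `#Ш(E/ℚ) < ∞`."
Followed by (p. 326): "Note that the 'in particular' clause in Theorem A follows from combining its
conclusion with the fundamental work of Gross–Zagier, Kolyvagin, and Rubin. In turn, this
consequence yields the following mod `p` criterion for analytic rank one." Preceded by (p. 326):
"Our main result is the following CM `p`-converse theorem. For primes `p > 3`, the result was first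
proved in [12]" ([12] = Burungale–Tian, Invent. Math. 220 (2020) — the tree's fact
`burungaleTian_analyticRank_eq_one_of_selmerCorank_eq_one_of_hasCM`, `BSDSelmerCMPConverse.lean`).
Abstract (p. 325): "Let `E/ℚ` be a CM elliptic curve and `p` a prime of good ordinary reduction
for `E`. We show that if `Sel_{p^∞}(E/ℚ)` has `ℤ_p`-corank one, then `E(ℚ)` has a point of infinite
order. The non-torsion point arises from a Heegner point, and thus `ord_{s=1} L(E, s) = 1` […]. For
`p > 3`, this gives a new proof of the main result of [12], which our approach extends to all
primes."

**Corollary B, verbatim** (p. 327): "Let `(E, K)` be as in Theorem A, and let `p` be a prime of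
good ordinary reduction for `E` such that: (i) `E(ℚ)[p] = 0`; (ii) `Sel_p(E/ℚ) ≃ ℤ/pℤ`, where
`Sel_p(E/ℚ) ⊂ H¹(ℚ, E[p])` is the `p`-Selmer group of `E`. Then `ord_{s=1} L(E, s) = 1` and
`Ш(E/ℚ)[p^∞] = 0`." (A consequence of Thm. A's "in particular" clause — see §"Not vendored".)

**Theorem 8.2, verbatim** (p. 343; "recovers Theorem A in the introduction as a special case"):
"Let `λ` be a self-dual Hecke character of `K` of infinity type `(−1, 0)` with central character
`ω_λ = η_K` and whose conductor `𝔣_λ` satisfies `𝔡_K ∥ 𝔣_λ`. Then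
`corank_𝒪 Sel_{𝔓^∞}(B_λ/K) = 1 ⟹ ord_{s=1} L(λ, s) = 1`." Standing hypotheses of §§7–8 (p. 341):
"`K` is an imaginary quadratic field of discriminant `−D_K < 0` satisfying (spl)", (spl) =
"`p𝒪_K = v v̄` splits in `K`" (p. 329). §8 (p. 342) lists the hypotheses on `λ` as "(a) `λ` has
sign `−1`; (b) `λ` has central character `ω_λ = η_K`; (c) `𝔡_K ∥ 𝔣_λ`. Note that `𝔣_λ` is
divisible by `𝔡_K = (√−D_K)` by condition (b). Since `λ` is self-dual, `𝔣_λ` is invariant under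
complex conjugation, so by condition (c) we can write `𝔣_λ = (c)𝔡_K` for a unique `c > 0`."

HYPOTHESES ENUMERATED (Thm. A as printed): `E/ℚ`; CM by an ORDER (any) of an imaginary quadratic
`K`, `disc K = −D_K`; the conductor `𝔣_λ` of the Hecke character `λ` of `K` attached to `E`
(`L(E, s) = L(λ, s)`, p. 327) is EXACTLY divisible by the different `𝔡_K = (√−D_K)`; `p` ANY prime
(no parity or size restriction) of GOOD ORDINARY reduction; `corank_{ℤ_p} Sel_{p^∞}(E/ℚ) = 1`. No
image, torsion, `Ш`-finiteness, Tamagawa or root-number hypothesis. Refereed: PUBLISHED.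

## Transcription

`W` a globally minimal Weierstrass equation of `E` over `ℚ` (only to read the true `a_p` as
`W.frobeniusTrace p`, as in the Burungale–Tian fact); "CM by an order of `K`" = the tree's
`W.HasCM` (geometric CM: `End_{ℚ̄}(E)` is an order in an imaginary quadratic field `K`; the CM
field discriminant `d_K = −D_K` is read off `j(E)` by the cell's table
`Rank1Residual.cmFieldDiscrOfJ`, all thirteen CM `j`-invariants); good ordinary at `p` =
`W.HasGoodReductionAtPrime p ∧ ¬ p ∣ a_p` (the cell's `GoodOrd`); `corank` = `W.selmerCorank p`;
conclusion `W.analyticRank = 1`.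

**The conductor hypothesis.** "the Hecke character associated to `E` has conductor exactly
divisible by `𝔡_K`", i.e. §8 (c) `𝔡_K ∥ 𝔣_λ`: for every prime `𝔭 ∣ 𝔡_K` of `K` (= every ramified
prime), `v_𝔭(𝔣_λ) = v_𝔭(𝔡_K)` (this is the reading the paper uses: "`𝔣_λ = (c)𝔡_K` for a unique
`c > 0`", p. 342). The tree has no Grössencharacter attached to a CM elliptic curve (its Deuring
theorem `Deuring_LFunction_baseChange_cmField` is deliberately Grössencharacter-free), so the
hypothesis is transcribed ARITHMETICALLY, on the conductor `N_E = W.conductorNorm ℤ`, by the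
level formula printed in the paper itself: `L(E, s) = L(λ, s)` (p. 327) and "`f = θ_ψ` […] has
level `N = D_K · N(𝔣_ψ)`" (§3.3, p. 334, for any Hecke character `ψ` of infinity type `(−1, 0)`),
so that — `θ_λ` being the newform of `E`, whose level is `N_E` (Carayol; tree fact
`IsNewformOf.level_eq_conductorNorm`) — `N_E = D_K · N_{K/ℚ}(𝔣_λ)`. At a ramified rational prime
`ℓ ∣ D_K`, with `𝔭² = (ℓ)`, `N(𝔭) = ℓ`: `v_ℓ(N_E) = v_ℓ(D_K) + v_𝔭(𝔣_λ)` and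
`v_𝔭(𝔡_K) = v_𝔭(√−D_K) = ½ v_𝔭(D_K) = v_ℓ(D_K)`; hence
`𝔡_K ∥ 𝔣_λ ⟺ ∀ ℓ ∣ D_K prime, v_ℓ(N_E) = 2 · v_ℓ(D_K)` — the predicate
`DifferentExactlyDividesHeckeConductor W` below (for odd `ℓ ∣ D_K`: `v_ℓ(N_E) = 2`; for `ℓ = 2`,
`4 ∣ D_K`: `v_2(N_E) = 2 v_2(D_K) ∈ {4, 6}`). Worked instances (conductor = Cremona label prefix):
`y² + y = x³` (27a, `d_K = −3`): `v_3(27) = 3 ≠ 2` — hypothesis FAILS; `y² = x³ + 1` (36a,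
`d_K = −3`): `v_3(36) = 2` — holds; 49a (`d_K = −7`): `v_7(49) = 2` — holds; 121b (`d_K = −11`):
`v_11(121) = 2` — holds; `y² = x³ − x` (32a, `d_K = −4`): `v_2(32) = 5 ≠ 4` — fails. For
`d_K ∈ {−7, −11, −19, −43, −67, −163}` the hypothesis is AUTOMATIC (the unique ramified prime
`ℓ = −d_K ≥ 7` is a prime of additive reduction of a CM curve — `ℓ ∣ D_K ∣ N_E` — and `f_ℓ = 2` for
additive `ℓ ≥ 5`, tree theorem `conductorExponent_eq_two_of_five_le_holds`); it is a genuine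
restriction only for `d_K ∈ {−3, −4, −8}`. This remark is documentation; the Lean fact keeps the
hypothesis explicit for every `d_K` (faithfulness: never weaker than print).

NOT PROVABLE from Mathlib or this library at present (no `_holds`): the printed proof (§§2–8)
needs the CM abelian varieties `B_ψ`, `A_f` of `GL₂`-type attached to Hecke characters / CM forms
(Casselman–Shimura, §2.1), `Λ`-adic Heegner classes `z_{f,χ}` on `X₁(N)` and Perrin-Riou's Heegner
point main conjecture (Conj. 2.2), anticyclotomic Selmer groups of Rankin–Selberg convolutions and
of Hecke characters (§3), the BDP `p`-adic `L`-function `ℒ_v(f, χ)` (Castella–Hsieh) and Katz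
`p`-adic `L`-functions with the factorisation `ℒ_v(θ_ψ, χ)² ≐ ℒ_v(ψ*χ*) · ℒ_v(ψχ*)` (Prop. 4.5),
the `Λ`-adic explicit reciprocity law `Log_v(loc_v(z_{f,χ})) = c · ℒ_v(f, χ)` (Thm. 5.1, from
Castella–Hsieh + Loeffler–Zerbes), the equivalence of main conjectures by Poitou–Tate (Thm. 5.2),
Rubin's two-variable main conjecture for `K` at ALL `p` (Johnson-Leung–Kings, Oukhaba–Viguié
removing `p ∤ #𝒪_K^×`) descended to the anticyclotomic line (Thm. 6.1), Agboola–Howard / Arnold,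
the `Λ`-non-torsionness of `z_{f,χ}` (Burungale–Disegni), Gross–Zagier (Yuan–Zhang–Zhang,
Cai–Shu–Tian), Nekovář's parity theorem and a variant of Mazur's control theorem (§§7–8). None of
these objects exists in the tree. Consumers take `(h : thmA_analyticRank_eq_one_of_selmerCorank_eq_one)`.

## What is proved here (bookkeeping only; no new fact besides Thm. A)

* `thmA_inParticular` — the "In particular" clause (rank `1`, `Ш` finite) from the fact and
  Gross–Zagier–Kolyvagin(–Rubin) `rank_eq_analyticRank_of_analyticRank_le_one` (as for
  Burungale–Tian: `mordellWeilRank_eq_one_and_finite_sha_of_burungaleTian`).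
* `thmA_iff_small_primes_of_burungaleTian` — GIVEN the Burungale–Tian fact (`p ≥ 5`, no conductor
  hypothesis), Theorem A is EQUIVALENT to its cases `p ∈ {2, 3}`: the new content of the theorem
  over the tree is exactly the `p = 2, 3` corner (p. 326 "For primes `p > 3`, the result was first
  proved in [12]"; abstract "which our approach extends to all primes").
* The `p = 2, 3` corner made explicit. A good prime `p` of a CM curve is ORDINARY iff `p` SPLITS in
  `K` (Deuring; the tree's named fact `deuring_not_hasUnitRootAt_of_hasCM_of_not_cmSplit`, Lang
  *Elliptic Functions* 13 §4 Thm. 12, gives the direction needed: `cmSplit_of_hasCM_of_goodOrd`).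
  By the table of the thirteen CM `j`-invariants: `2` splits in `K` iff `d_K = −7`
  (`cmFieldDiscrOfJ_eq_of_cmSplit_two`), `3` splits iff `d_K ∈ {−8, −11}`
  (`cmFieldDiscrOfJ_eq_of_cmSplit_three`). Hence (`cmFieldDiscrOfJ_eq_of_goodOrd_two/three`):
  **at `p = 2` Theorem A speaks exactly about the curves with `j ∈ {−3375, 16581375}`
  (`K = ℚ(√−7)`, where (c) is automatic) of good reduction at `2`; at `p = 3` about
  `j = −32768` (`K = ℚ(√−11)`, (c) automatic) and `j = 8000` (`K = ℚ(√−2)`, (c) ⟺ `v_2(N_E) = 6`)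
  of good reduction at `3`.** Remark D (p. 327) on `p = 2`: "`ℚ(√−7)` is the only imaginary
  quadratic field of class number 1 with `2` split, and incidentally `E(ℚ)[2] ≃ ℤ/2ℤ` for all
  elliptic curves `E/ℚ` with CM by `ℚ(√−7)`"; and Theorem A needs GOOD (not potentially good)
  ordinary reduction at `p`.

## Not vendored (and why)

* Cor. B (p. 327) — a corollary of Thm. A + Gross–Zagier–Kolyvagin–Rubin + Cassels–Tate
  (`#Sel_p = #(E/pE) · #Ш[p]`; a `p`-primary `Ш` with cyclic `p`-torsion is `0` or `ℚ_p/ℤ_p`);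
  not restated as a separate binder (D-0026: no corollary dressed as a fact). It is PROVED as a
  theorem on the Summits side: `Summit.BirchSwinnertonDyer.Rank1Residual.X12.corB`
  (`Summits/BirchSwinnertonDyer/Rank1Residual/X12/CMModPCriterion.lean`, below this fact, GZK and
  bsd.S18), with the descent-datum half `X12.selmerCorank_eq_one_of_natCard_selmerGroup_eq`
  (`E(K)[p] = 0 ∧ #Sel_p(E/K) = p ⟹ corank_{ℤ_p} Sel_{p^∞}(E/K) = 1`, any number field) in
  `X12/PDescentSelmerCorank.lean`; there hypothesis (i) `E(ℚ)[p] = 0` is shown AUTOMATIC at every odd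
  good ordinary `p` (`X12.noPTorsion_of_hasCM_of_goodOrd`), and at `p = 2` it always fails (Rem. D),
  so Cor. B is a statement about odd good ordinary `p`. The cell's certificate theorem
  `Typed.noPTorsion_of_card_selmerGroup_eq_prime` is the non-CM twin (needs a generator datum).
* Thm. 8.2 (general `B_λ`), Thm. 7.1 / Cor. 7.2 (one divisibility of the Heegner point main
  conjecture Conj. 2.2 for `(θ_ψ, χ)`, `ψχ` of sign `−1`), Thm. 6.1 (twisted anticyclotomic main
  conjectures for `K` at every split `p`: `char_Λ X_v(ψχ*) = (ℒ_v(ψχ*))` and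
  `char_Λ X_v(ψ*χ*) ⊂ (ℒ_v(ψ*χ*))`), Thm. 5.1 / 5.2 (explicit reciprocity law; equivalence of
  Conj. 2.2 and the Greenberg main conjecture Conj. 4.3), Lemma 8.1 (Selmer decomposition
  `corank Sel(A_{f,χ}/K) = corank H¹_f(K, W_{ψ*χ*}) + corank H¹_f(K, W_{ψχ*})`) — each needs
  objects absent from the tree and from Mathlib (CM abelian varieties of Hecke characters, Katz /
  BDP `p`-adic `L`-functions, `Λ`-adic Heegner classes, anticyclotomic Selmer groups of characters);
  typing any of them as a `def … : Prop` today would be a vocabulary construction, not a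
  transcription (reported in the seat's deliverable `HOME/b2b-bsdres-lit-bst/BST-BCST.md` §2).
  TODO(general form): Thm. 8.2.
* Unpublished companions (OPEN, never citable as theorems in this cell): Burungale–Skinner–Tian,
  *Elliptic curves and Beilinson–Kato elements: rank one aspects* (preprint 2020/21, not public;
  absorbed into Burungale–Skinner–Tian–Wan arXiv:2409.01350, itself a preprint); ref. [4]
  Burungale–Castella–Skinner–Tian, *`p`-converse …: CM elliptic curves over totally real fields*
  (preprint 2021); ref. [47] Ressler–Yu (in preparation) / [52] Q. Yu, Caltech senior thesis 2021
  (the same `p`-converse WITHOUT the conductor hypothesis, Remark C p. 327) — none has appeared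
  (arXiv / Crossref, 2026-08-20).

## Proof status at `p = 2` (literature audit 2026-08-25, cell `bsd-goldfeld`, `HOME/R1-AUDIT.md`)

The STATEMENT is refereed for every good ordinary `p` (Thm. A; abstract "extends to all primes") and
the fact below is transcribed exactly so (faithfulness: never weaker than print). Consumers who
instantiate it at `p = 2` (`K = ℚ(√−7)`, `j ∈ {−3375, 16581375}`; e.g. the Goldfeld assembly for the
twists of `X₀(49)` good at `2`) should know that the printed PROOF cites, at three load-bearing steps,
inputs stated for odd `p` only (each opened at the locator given): Thm. 5.1 (p. 338: the `Λ`-adic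
big logarithm `Log_v` and the explicit reciprocity law `Log_v(loc_v z_{f,χ}) = c · ℒ_v(f, χ)`
"follows from the two-variable extension by Loeffler–Zerbes [33] … and … [19, §5.3]") ←
Castella–Hsieh, Math. Ann. 370 (2018) §1 "Fix an odd prime `p ∤ N`" and Loeffler–Zerbes, IJNT 10
(2014) §2.1 "Let `p` be an odd prime" (used through `Γ ≅ Δ × Γ₁`, `#Δ = p − 1` prime to `p`);
Thm. 4.4 (p. 336, Katz measure "construction in [28]") ← Hsieh, Crelle 688 (2014) §1 "Let `p > 2`
be an odd rational prime"; Thm. 7.1 (i) (p. 341, "follows from [5, Thm. 1.1]") ← Burungale–Disegni,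
AIF 70 (2020) Thm. 1.1 "suppose that `p ∤ 2 D_F h_E^−`". For the last two, `p = 2` substitutes
exist in print in substance (two-variable `2`-adic measures for split `2`, as used by
Li–Tian–Yan–Zhu, PAMQ 21 (2025) §§5–8; Rohrlich's generic non-vanishing in anticyclotomic towers,
Invent. Math. 75 (1984), as restated in Agboola–Howard, AIF 56 (2006) §3); the remaining inputs
(Thm. 6.1 via Johnson-Leung–Kings ⊗ ℚ; Thm. 7.1 (ii) via Yuan–Zhang–Zhang, Nekovář LMS LN 320
(2007) Thm. 3.2 applied through an auxiliary imaginary quadratic field as in Nekovář, CJM 64 (2012)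
§2.10, and Nekovář 2012 Thm. B (a); `2`-parity for `E/ℚ` by Dokchitser–Dokchitser 2010) are
`p`-uniform in print. No `p = 2` version of the explicit reciprocity law of Thm. 5.1 was found in
print (2026-08-25); the `p = 2` case is ASSERTED in this paper's abstract, in Burungale–Skinner,
App. A to arXiv:2210.10730, Thm. 10.3 + Rem. 10.5 (i) ("all these results allow for `p = 2`"), and in
Li–Tian–Yan–Zhu 2025 Thm. 1.2; the only written `p = 2`-specific argument is [52] (unrefereed
senior thesis), and [47] never appeared. Nothing in print suggests the statement fails at `p = 2`.
This paragraph is documentation only; it changes no declaration.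

## Which cells of the partition grid this bears on (HOME/PARTITION.md)

Rank-PART statements only (`corank 1 ⟹ r_an = 1`), i.e. the `p`-converse input `hconv1` of the
lane's density / residual-cell assemblies (`BSDRankResidualCellsProofs`,
`BSDLowerBoundLayersProofs`) on the CM sector at `p ∈ {2, 3}` good ordinary, where the tree had no
theorem (Burungale–Tian: `p ≥ 5`; Burungale–Kobayashi–Ota: supersingular `p ≥ 5`; Rubin: needs
`#Ш[p^∞] < ∞`). It is NOT a `p`-part-of-BSD statement: class X12 (`cm ∧ r = 1 ∧ (p = 2 ∨ …)`)
is untouched — at `p = 2` split (`K = ℚ(√−7)`, good at `2`) the BSD formula's `2`-part remains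
CONSTRUCTION-shaped (Li–Liu–Tian 2024 Thm. 1.1 (i) excludes `p = 2`).

## References

* [BurungaleCastellaSkinnerTian2022] Ann. Math. Québec 46 (2022) 325–346: abstract (p. 325),
  Thm. A + the two sentences after it (p. 326), Cor. B, Rem. C, Rem. D, "The approach" (p. 327),
  (1.1)–(1.2) (pp. 327–328), (Heeg)/(spl) (p. 329), Conj. 2.2 (p. 331), §3.3 level formula (p. 334),
  Thm. 5.1/5.2 (p. 338), Thm. 6.1 (p. 340), Thm. 7.1 (p. 341), Cor. 7.2 + §8 (a)–(c) (p. 342),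
  Lemma 8.1 + Thm. 8.2 (p. 343), proof of Thm. 8.2 (p. 344), refs [4], [12], [47], [52] (pp. 345–346).
* [BurungaleTian2019] A. Burungale, Y. Tian, Invent. Math. 220 (2020) 211–253, Thm. 1.2 (`p > 3`).
* [Lang1987] S. Lang, *Elliptic Functions*, GTM 112, Ch. 13 §4 Thm. 12 (Deuring's criterion).
* [SilvermanATAEC1994] J. H. Silverman, *Advanced Topics*, App. A §3 (the thirteen CM `j`'s).
* [Darmon2004] H. Darmon, CBMS 101, Thm. 3.22 (Gross–Zagier–Kolyvagin).
* [GreenbergLNM1716] R. Greenberg, LNM 1716, Thm. 1.2 / §4 p. 103 (unit root = `p ∤ a_p`).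
-/

noncomputable section

open scoped Classical

open WeierstrassCurve IsDedekindDomain NumberField
open Literature.NumberTheory.EllipticCurves Literature.NumberTheory.EllipticCurves.Rank1Residual

namespace Literature.NumberTheory.EllipticCurves.BurungaleCastellaSkinnerTian2022

/-! ### The conductor hypothesis of Theorem A, transcribed on `N_E` -/

/-- **Hypothesis of Theorem A / §8 (c): "the Hecke character associated to `E` has conductor
exactly divisible by `𝔡_K := (√−D_K)`", `𝔡_K ∥ 𝔣_λ`** (pp. 326, 342), transcribed on the
conductor `N_E = W.conductorNorm ℤ` through the printed level formula `N_E = D_K · N_{K/ℚ}(𝔣_λ)`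
(`L(E, s) = L(λ, s)`, p. 327; "`θ_ψ` has level `D_K · N(𝔣_ψ)`", §3.3 p. 334; the newform of `E`
has level `N_E`): for every rational prime `ℓ ∣ D_K` (`D_K = −d_K`, `d_K = cmFieldDiscrOfJ j(E)`
the CM field discriminant), `v_ℓ(N_E) = 2 · v_ℓ(D_K)` — equivalently `v_𝔭(𝔣_λ) = v_𝔭(𝔡_K)` at
the prime `𝔭` of `K` above `ℓ` (module docstring, "The conductor hypothesis"). For odd `ℓ ∣ D_K`
this reads `v_ℓ(N_E) = 2`; for `ℓ = 2 ∣ D_K`, `v_2(N_E) = 2 v_2(D_K)`. Automatic when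
`d_K ∈ {−7, −11, −19, −43, −67, −163}`; a restriction when `d_K ∈ {−3, −4, −8}`.
[cite: BurungaleCastellaSkinnerTian2022, Thm. A (p. 326), §8 (c) (p. 342), §3.3 (p. 334)] -/
def DifferentExactlyDividesHeckeConductor (W : WeierstrassCurve ℚ) [W.IsElliptic] : Prop :=
  ∀ ℓ : ℕ, ℓ.Prime → (ℓ : ℤ) ∣ cmFieldDiscrOfJ W.j →
    (W.conductorNorm ℤ).factorization ℓ = 2 * (cmFieldDiscrOfJ W.j).natAbs.factorization ℓ

/-- Unfolding of the transcribed conductor hypothesis.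
[cite: BurungaleCastellaSkinnerTian2022, Thm. A (p. 326), §8 (c) (p. 342)] -/
theorem differentExactlyDividesHeckeConductor_iff (W : WeierstrassCurve ℚ) [W.IsElliptic] :
    DifferentExactlyDividesHeckeConductor W ↔
      ∀ ℓ : ℕ, ℓ.Prime → (ℓ : ℤ) ∣ cmFieldDiscrOfJ W.j →
        (W.conductorNorm ℤ).factorization ℓ = 2 * (cmFieldDiscrOfJ W.j).natAbs.factorization ℓ :=
  Iff.rfl

/-! ### Theorem A (named fact) -/

/-- **Burungale–Castella–Skinner–Tian 2022, Theorem A** (Ann. Math. Québec 46 (2022), p. 326),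
verbatim: "Let `E/ℚ` be an elliptic curve with complex multiplication by an order of an imaginary
quadratic field `K` of discriminant `−D_K < 0`. Assume that the Hecke character associated to `E`
has conductor exactly divisible by `𝔡_K := (√−D_K)`. Let `p` be a prime of good ordinary
reduction for `E`. Then `corank_{ℤ_p} Sel_{p^∞}(E/ℚ) = 1 ⟹ ord_{s=1} L(E, s) = 1`. In
particular, if `corank_{ℤ_p} Sel_{p^∞}(E/ℚ) = 1` then `rank_ℤ E(ℚ) = 1` and `#Ш(E/ℚ) < ∞`."
(`p` is ANY prime — "which our approach extends to all primes", abstract p. 325; "For primes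
`p > 3`, the result was first proved in [12]" = Burungale–Tian 2020.) Transcription: `W/ℚ`
globally minimal (to read `a_p`); `W.HasCM` (CM by an order of an imaginary quadratic field, the
CM field being `ℚ(√d_K)`, `d_K = cmFieldDiscrOfJ j(W) = −D_K`); the conductor hypothesis as
`DifferentExactlyDividesHeckeConductor W` (previous docstring); `p` prime; good reduction at `p`
and `p ∤ a_p` (good ordinary); `corank_{ℤ_p} Sel_{p^∞}(E/ℚ) = 1` (`W.selmerCorank p = 1`);
conclusion `ord_{s=1} L(E, s) = 1` (`W.analyticRank = 1`). The "In particular" clause is the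
THEOREM `thmA_inParticular` below; the general form Thm. 8.2 (CM abelian varieties `B_λ`) is not
vendored (no vocabulary). Nothing weaker or stronger is vendored; no `_holds` (module docstring:
the proof needs Heegner-class Iwasawa theory absent from the tree). PUBLISHED and refereed.
[cite: BurungaleCastellaSkinnerTian2022, Thm. A (p. 326); abstract (p. 325); Thm. 8.2 (p. 343)] -/
def thmA_analyticRank_eq_one_of_selmerCorank_eq_one : Prop :=
  ∀ (W : WeierstrassCurve ℚ) [W.IsElliptic] [W.IsGloballyMinimal] (_hCM : W.HasCM)
    (_hcond : DifferentExactlyDividesHeckeConductor W) (p : ℕ) [Fact p.Prime]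
    (_hgood : W.HasGoodReductionAtPrime p) (_hord : ¬ (p : ℤ) ∣ W.frobeniusTrace p)
    (_h : W.selmerCorank p = 1), W.analyticRank = 1
-- TODO(general form): Burungale–Castella–Skinner–Tian 2022, Thm. 8.2 (p. 343) — the same
-- `p`-converse for the CM abelian varieties `B_λ/K` of self-dual Hecke characters `λ` of `K` of
-- infinity type `(−1, 0)` with `ω_λ = η_K` and `𝔡_K ∥ 𝔣_λ`, `p` split in `K`:
-- `corank_𝒪 Sel_{𝔓^∞}(B_λ/K) = 1 ⟹ ord_{s=1} L(λ, s) = 1`; needs CM abelian varieties attached to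
-- Hecke characters, which the tree lacks.

/-! ### The "In particular" clause (proved from the fact + Gross–Zagier–Kolyvagin–Rubin) -/

/-- **Theorem A, "In particular" clause** (p. 326): "if `corank_{ℤ_p} Sel_{p^∞}(E/ℚ) = 1` then
`rank_ℤ E(ℚ) = 1` and `#Ш(E/ℚ) < ∞`" — "follows from combining its conclusion with the fundamental
work of Gross–Zagier, Kolyvagin, and Rubin" (p. 326): from the fact (hypothesis `h`) and
`ord_{s=1} L(E, s) ≤ 1 ⟹ rank = ord ∧ #Ш < ∞` (hypothesis `hGZK`, the named fact
`rank_eq_analyticRank_of_analyticRank_le_one`, Darmon CBMS 101 Thm. 3.22).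
[cite: BurungaleCastellaSkinnerTian2022, Thm. A ("In particular" clause) and the sentence after it (p. 326)]
[cite: Darmon2004, Thm. 3.22] -/
theorem thmA_inParticular (h : thmA_analyticRank_eq_one_of_selmerCorank_eq_one)
    (hGZK : rank_eq_analyticRank_of_analyticRank_le_one)
    (W : WeierstrassCurve ℚ) [W.IsElliptic] [W.IsGloballyMinimal] (hCM : W.HasCM)
    (hcond : DifferentExactlyDividesHeckeConductor W) (p : ℕ) [Fact p.Prime]
    (hgood : W.HasGoodReductionAtPrime p) (hord : ¬ (p : ℤ) ∣ W.frobeniusTrace p)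
    (hcorank : W.selmerCorank p = 1) :
    W.analyticRank = 1 ∧ W.mordellWeilRank = 1 ∧ Finite W.sha := by
  have h1 : W.analyticRank = 1 := h W hCM hcond p hgood hord hcorank
  obtain ⟨hrank, hsha⟩ := hGZK W h1.le
  exact ⟨h1, by rw [hrank, h1], hsha⟩

/-! ### Given Burungale–Tian (`p ≥ 5`), Theorem A is its `p ∈ {2, 3}` corner -/

/-- A prime other than `2` and `3` is at least `5`. [folklore] -/
private theorem five_le_of_prime_of_ne {p : ℕ} (hp : p.Prime) (h2 : p ≠ 2) (h3 : p ≠ 3) :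
    5 ≤ p := by
  by_contra h
  push Not at h
  interval_cases p <;> simp_all (config := { decide := true })

/-- **What Theorem A adds to Burungale–Tian 2020 is exactly the primes `p = 2, 3`.** Granted the
tree's Burungale–Tian fact (`p > 3` good ordinary, CM, NO conductor hypothesis:
`burungaleTian_analyticRank_eq_one_of_selmerCorank_eq_one_of_hasCM`), Theorem A is equivalent to
its restriction to `p ∈ {2, 3}` (p. 326: "For primes `p > 3`, the result was first proved in
[12]"; abstract: "which our approach extends to all primes"). The restricted statement is inlined,
not a separate binder. [cite: BurungaleCastellaSkinnerTian2022, Thm. A and the paragraph before it (p. 326); abstract (p. 325)]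
[cite: BurungaleTian2019, Thm. 1.2 (p. 214)] -/
theorem thmA_iff_small_primes_of_burungaleTian
    (hBT : burungaleTian_analyticRank_eq_one_of_selmerCorank_eq_one_of_hasCM) :
    thmA_analyticRank_eq_one_of_selmerCorank_eq_one ↔
      ∀ (W : WeierstrassCurve ℚ) [W.IsElliptic] [W.IsGloballyMinimal], W.HasCM →
        DifferentExactlyDividesHeckeConductor W → ∀ (p : ℕ) [Fact p.Prime], (p = 2 ∨ p = 3) →
          W.HasGoodReductionAtPrime p → ¬ (p : ℤ) ∣ W.frobeniusTrace p →
            W.selmerCorank p = 1 → W.analyticRank = 1 := by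
  refine ⟨fun h W _ _ hCM hcond p _ _ hgood hord hc ↦ h W hCM hcond p hgood hord hc,
    fun h W _ _ hCM hcond p _ hgood hord hc ↦ ?_⟩
  by_cases h23 : p = 2 ∨ p = 3
  · exact h W hCM hcond p h23 hgood hord hc
  · push Not at h23
    exact hBT W hCM p (five_le_of_prime_of_ne (Fact.out : p.Prime) h23.1 h23.2) hgood hord hc

/-! ### The `p = 2, 3` corner: which CM curves have `2` resp. `3` as a (good) ORDINARY prime -/

/-- The values of the cell's CM-field-discriminant table `cmFieldDiscrOfJ` (the nine fundamental
discriminants of class number one, and the junk value `0` off the thirteen CM `j`-invariants).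
[cite: SilvermanATAEC1994, App. A §3 (table of CM j-invariants)] -/
theorem cmFieldDiscrOfJ_cases (j : ℚ) :
    cmFieldDiscrOfJ j = -3 ∨ cmFieldDiscrOfJ j = -4 ∨ cmFieldDiscrOfJ j = -7 ∨
      cmFieldDiscrOfJ j = -8 ∨ cmFieldDiscrOfJ j = -11 ∨ cmFieldDiscrOfJ j = -19 ∨
      cmFieldDiscrOfJ j = -43 ∨ cmFieldDiscrOfJ j = -67 ∨ cmFieldDiscrOfJ j = -163 ∨
      cmFieldDiscrOfJ j = 0 := by
  unfold cmFieldDiscrOfJ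
  split_ifs <;> simp

/-- **`2` splits in the CM field iff `K = ℚ(√−7)`**: among the CM field discriminants over `ℚ`
(`−3, −4, −7, −8, −11, −19, −43, −67, −163`) only `−7 ≡ 1 (mod 8)` (Remark D, p. 327: "`ℚ(√−7)`
is the only imaginary quadratic field of class number 1 with `2` split"). In the cell's vocabulary:
`CMSplit W 2 → d_K = −7`, i.e. `j(W) ∈ {−3375, 16581375}`.
[cite: BurungaleCastellaSkinnerTian2022, Rem. D (p. 327)] [cite: SilvermanATAEC1994, App. A §3] -/
theorem cmFieldDiscrOfJ_eq_of_cmSplit_two (W : WeierstrassCurve ℚ) [W.IsElliptic]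
    (h : CMSplit W 2) : cmFieldDiscrOfJ W.j = -7 := by
  obtain ⟨_, h8⟩ := h
  simp only [if_true] at h8
  rcases cmFieldDiscrOfJ_cases W.j with hd | hd | hd | hd | hd | hd | hd | hd | hd | hd <;>
    rw [hd] at h8 ⊢ <;> omega

/-- Conversely `d_K = −7` gives `CMSplit W 2`. [cite: SilvermanATAEC1994, App. A §3] -/
theorem cmSplit_two_of_cmFieldDiscrOfJ_eq (W : WeierstrassCurve ℚ) [W.IsElliptic]
    (h : cmFieldDiscrOfJ W.j = -7) : CMSplit W 2 := by
  refine ⟨?_, ?_⟩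
  · rw [h]; decide
  · simp only [if_true]; rw [h]; decide

/-- **`3` splits in the CM field iff `K ∈ {ℚ(√−2), ℚ(√−11)}`**: among the CM field discriminants
only `−8` and `−11` are prime to `3` and squares mod `3`. In the cell's vocabulary:
`CMSplit W 3 → d_K ∈ {−8, −11}`, i.e. `j(W) ∈ {8000, −32768}`.
[cite: SilvermanATAEC1994, App. A §3 (table of CM j-invariants)] -/
theorem cmFieldDiscrOfJ_eq_of_cmSplit_three (W : WeierstrassCurve ℚ) [W.IsElliptic]
    (h : CMSplit W 3) : cmFieldDiscrOfJ W.j = -8 ∨ cmFieldDiscrOfJ W.j = -11 := by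
  obtain ⟨h3, hsq⟩ := h
  simp only [show (3 : ℕ) ≠ 2 by decide, if_false] at hsq
  rcases cmFieldDiscrOfJ_cases W.j with hd | hd | hd | hd | hd | hd | hd | hd | hd | hd <;>
    rw [hd] at h3 hsq ⊢ <;> revert h3 hsq <;> decide

/-- Conversely `d_K ∈ {−8, −11}` gives `CMSplit W 3`. [cite: SilvermanATAEC1994, App. A §3] -/
theorem cmSplit_three_of_cmFieldDiscrOfJ_eq (W : WeierstrassCurve ℚ) [W.IsElliptic]
    (h : cmFieldDiscrOfJ W.j = -8 ∨ cmFieldDiscrOfJ W.j = -11) : CMSplit W 3 := by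
  rcases h with h | h
  · refine ⟨?_, ?_⟩
    · rw [h]; decide
    · simp only [show (3 : ℕ) ≠ 2 by decide, if_false]; rw [h]; decide
  · refine ⟨?_, ?_⟩
    · rw [h]; decide
    · simp only [show (3 : ℕ) ≠ 2 by decide, if_false]; rw [h]; decide

/-- **A good ORDINARY prime of a CM curve splits in the CM field** (Deuring's criterion, the
direction "non-split ⟹ supersingular": hypothesis `hDeu`, the tree's named fact
`deuring_not_hasUnitRootAt_of_hasCM_of_not_cmSplit`, Lang *Elliptic Functions* 13 §4 Thm. 12),
read over `ℚ` at the unique place above `p` through `HasUnitRootAt ⟺ p ∤ a_p`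
(`hasUnitRootAt_iff_not_dvd_frobeniusTrace`, Greenberg LNM 1716 §4). This is why "prime of good
ordinary reduction" in Theorem A means "good prime split in `K`" ((spl), p. 329).
[cite: Lang1987, Ch. 13 §4 Thm. 12] [cite: GreenbergLNM1716, Thm 1.2 and §4 p. 103]
[cite: BurungaleCastellaSkinnerTian2022, (spl) (p. 329)] -/
theorem cmSplit_of_hasCM_of_goodOrd (hDeu : deuring_not_hasUnitRootAt_of_hasCM_of_not_cmSplit)
    (W : WeierstrassCurve ℚ) [W.IsElliptic] [W.IsGloballyMinimal] (hCM : W.HasCM) (p : ℕ)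
    [Fact p.Prime] (hgood : W.HasGoodReductionAtPrime p) (hord : ¬ (p : ℤ) ∣ W.frobeniusTrace p) :
    CMSplit W p := by
  by_contra hns
  obtain ⟨v, hv⟩ := exists_heightOneSpectrum_natCast_mem (K := ℚ) (Fact.out : p.Prime)
  obtain ⟨hgood', hunit⟩ := W.hasGoodReductionAt_and_hasUnitRootAt_of_rat hgood hord v hv
  have hb : W.baseChange ℚ = W := baseChange_self W
  exact hDeu W hCM p Fact.out hns ℚ v hv (hb.symm ▸ hgood') (hb.symm ▸ hunit)

/-- **The `p = 2` corner of Theorem A.** For a CM curve `E/ℚ` with GOOD ORDINARY reduction at `2`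
(the hypothesis of Theorem A at `p = 2`), the CM field is `ℚ(√−7)`: `d_K = −7`, i.e.
`j(E) ∈ {−3375, 16581375}` — where the conductor hypothesis is moreover automatic (`v_7(N_E) = 2`).
Granted Deuring's criterion `hDeu`. Remark D (p. 327) records the obstruction to USING this corner
for Goldfeld's conjecture via Smith (`E(ℚ)[2] ≃ ℤ/2ℤ` for all such `E`; potentially good
reduction at `2` not allowed), not to the theorem itself.
[cite: BurungaleCastellaSkinnerTian2022, Thm. A (p. 326) and Rem. D (p. 327)]
[cite: Lang1987, Ch. 13 §4 Thm. 12] -/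
theorem cmFieldDiscrOfJ_eq_of_goodOrd_two
    (hDeu : deuring_not_hasUnitRootAt_of_hasCM_of_not_cmSplit) (W : WeierstrassCurve ℚ)
    [W.IsElliptic] [W.IsGloballyMinimal] (hCM : W.HasCM) [Fact (2 : ℕ).Prime]
    (hgood : W.HasGoodReductionAtPrime 2) (hord : ¬ ((2 : ℕ) : ℤ) ∣ W.frobeniusTrace 2) :
    cmFieldDiscrOfJ W.j = -7 :=
  cmFieldDiscrOfJ_eq_of_cmSplit_two W (cmSplit_of_hasCM_of_goodOrd hDeu W hCM 2 hgood hord)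

/-- **The `p = 3` corner of Theorem A.** For a CM curve `E/ℚ` with GOOD ORDINARY reduction at `3`,
the CM field is `ℚ(√−2)` or `ℚ(√−11)`: `d_K ∈ {−8, −11}`, i.e. `j(E) ∈ {8000, −32768}` (for
`d_K = −11` the conductor hypothesis is automatic; for `d_K = −8` it reads `v_2(N_E) = 6`).
Granted Deuring's criterion `hDeu`. [cite: BurungaleCastellaSkinnerTian2022, Thm. A (p. 326)]
[cite: Lang1987, Ch. 13 §4 Thm. 12] -/
theorem cmFieldDiscrOfJ_eq_of_goodOrd_three
    (hDeu : deuring_not_hasUnitRootAt_of_hasCM_of_not_cmSplit) (W : WeierstrassCurve ℚ)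
    [W.IsElliptic] [W.IsGloballyMinimal] (hCM : W.HasCM) [Fact (3 : ℕ).Prime]
    (hgood : W.HasGoodReductionAtPrime 3) (hord : ¬ ((3 : ℕ) : ℤ) ∣ W.frobeniusTrace 3) :
    cmFieldDiscrOfJ W.j = -8 ∨ cmFieldDiscrOfJ W.j = -11 :=
  cmFieldDiscrOfJ_eq_of_cmSplit_three W (cmSplit_of_hasCM_of_goodOrd hDeu W hCM 3 hgood hord)

/-- **Theorem A at `p = 2`, spelled out on its corner** (fact `h` + Deuring `hDeu`): a CM curve
`E/ℚ` with good ordinary reduction at `2` has `K = ℚ(√−7)`, and if `𝔡_K ∥ 𝔣_λ` (transcribed) and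
`corank_{ℤ_2} Sel_{2^∞}(E/ℚ) = 1` then `ord_{s=1} L(E, s) = 1` — the tree's first rank-one
`2`-converse on the CM sector (Burungale–Tian: `p > 3`). Pure bookkeeping.
[cite: BurungaleCastellaSkinnerTian2022, Thm. A (p. 326), Rem. D (p. 327)] -/
theorem analyticRank_eq_one_two_of_thmA (h : thmA_analyticRank_eq_one_of_selmerCorank_eq_one)
    (hDeu : deuring_not_hasUnitRootAt_of_hasCM_of_not_cmSplit) (W : WeierstrassCurve ℚ)
    [W.IsElliptic] [W.IsGloballyMinimal] (hCM : W.HasCM)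
    (hcond : DifferentExactlyDividesHeckeConductor W) [Fact (2 : ℕ).Prime]
    (hgood : W.HasGoodReductionAtPrime 2) (hord : ¬ ((2 : ℕ) : ℤ) ∣ W.frobeniusTrace 2)
    (hcorank : W.selmerCorank 2 = 1) :
    cmFieldDiscrOfJ W.j = -7 ∧ W.analyticRank = 1 :=
  ⟨cmFieldDiscrOfJ_eq_of_goodOrd_two hDeu W hCM hgood hord, h W hCM hcond 2 hgood hord hcorank⟩

end Literature.NumberTheory.EllipticCurves.BurungaleCastellaSkinnerTian2022

end
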